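import Mathlib
import HarnessLib
import Literature.Probability.MarkovChains.PathComparison

/-!
# Averaging over paths: comparison via randomized `E`-paths, `γ̃ ≤ [max π/π̃]·B·γ` with the congestion ratio (13.16) (Levin–Peres–Wilmer Corollary 13.23)

HONEST FRAMING: exact (Metropolis-corrected) sampling algorithms for lattice gauge theory; figures
of merit are autocorrelation/cost numbers at stated couplings and volumes; no continuum-physics claim.

Conventions of `PathComparison.lean` (`EPath x y`, `EPath.len = |Γ|`, `EPath.IsIn P` = "is an
`E`-path", `EPath.edgeCount`, `EPath.sq_sub_le`, `EPath.sum_range_eq_sum_edgeCount`, Theorem 13.20),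
`PeskunOrdering.lean` (`dirichletForm π P f = 𝓔(f)`), `SpectralGapVariational.lean` (`spectralGap = γ`)
and `DirichletFormComparison.lean` (Lemma 13.18).  Source: D. A. Levin, Y. Peres (with E. L. Wilmer),
*Markov Chains and Mixing Times*, 2nd ed., AMS 2017 [LevinPeres2017], §13.4.1 "Averaging over
paths".  Everything is PROVED (finite sums; 0 named facts).

Setting: for each pair `(x,y)` a finite set `𝒫xy` of paths from `x` to `y`, indexed by a finite type
`ι x y`, with paths `Γ x y i : EPath x y` and a probability vector `ν x y : ι x y → ℝ` on it ("a
measure `νxy` on the set `𝒫xy` of paths from `x` to `y` … how to select a random path between `x`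
and `y`"); only the pairs `(x,y) ∈ Ẽ = {P̃ > 0}` matter.

* `randEdgeCongestion π̃ P̃ Γ ν z w = Σ_{(x,y)} Q̃(x,y) Σ_{Γ ∈ 𝒫xy : e ∈ Γ} νxy(Γ)|Γ|` for `e = (z,w)`
  (membership counted with the multiplicity `edgeCount`, `= 1_{e ∈ Γ}` for paths without repeated
  edges) and the **CONGESTION RATIO (13.16)** `randCongestionRatio π P π̃ P̃ Γ ν =
  max_{e ∈ E} (1/Q(e)) Σ_{(x,y) ∈ Ẽ} Q̃(x,y) Σ_{Γ : e ∈ Γ ∈ 𝒫xy} νxy(Γ)|Γ|`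
  [cite: LevinPeres2017, §13.4.1 eq. (13.16)]; `randEdgeCongestion_le_ratio_mul`;
* `dirichletForm_le_mul_of_randEdgeCongestion_le` (all-pairs form) and
  **`LevinPeres2017_cor_13_23_dirichletForm`**: if every `Γ ∈ 𝒫xy` is an `E`-path for `(x,y) ∈ Ẽ`,
  `νxy ≥ 0` with `Σ νxy = 1` on `Ẽ`, and `Σ_{(x,y)} Q̃(x,y) Σ_{Γ ∋ e} νxy(Γ)|Γ| ≤ B·Q(e)` on `E`, then
  **`𝓔̃(f) ≤ B𝓔(f)`** for all `f` — "exactly parallel to" (13.14) (Exercise 13.3: `[f(x) − f(y)]² =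
  Σ_Γ νxy(Γ)[Σ_{e∈Γ} ∇f(e)]² ≤ Σ_Γ νxy(Γ)|Γ| Σ_{e∈Γ} [∇f(e)]²`, then exchange of summation)
  [cite: LevinPeres2017, §13.4.1 Cor 13.23 (proof "exactly parallel to that of Theorem 13.20",
  Exercise 13.3)];
* **COROLLARY 13.23** `LevinPeres2017_cor_13_23`: for reversible `P`, `P̃` with positive stationary
  probability vectors `π`, `π̃` (`|X| ≥ 2`) and `B` as above, **`γ̃ ≤ [max_x π(x)/π̃(x)]·B·γ`** (13.17);
  with `B` = the congestion ratio (13.16) itself: `LevinPeres2017_cor_13_23_ratio`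
  [cite: LevinPeres2017, §13.4.1 Cor 13.23 eq. (13.16)–(13.17)].

Context (cell pub-lqcd, venture LatticeQCDFlow): the randomized-path congestion bound is the form
used for diameter/transitivity bounds (LPW Thm 13.26) and for comparison of Glauber-type dynamics.
-/

namespace Literature.Probability.MarkovChains

open Finset Matrix

variable {X : Type*} [Fintype X] [DecidableEq X]
variable {ι : X → X → Type*} [∀ x y, Fintype (ι x y)]

/-! ## The randomized congestion ratio (13.16) -/

/-- The CONGESTION of the directed edge `e = (z,w)` under randomized paths:
`Σ_{(x,y)} Q̃(x,y) Σ_{Γ ∈ 𝒫xy : e ∈ Γ} νxy(Γ)|Γ|`, membership counted with the multiplicity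
`edgeCount` — the bracket in (13.16). [cite: LevinPeres2017, §13.4.1 eq. (13.16)] -/
def randEdgeCongestion (πt : X → ℝ) (Pt : Matrix X X ℝ) (Γ : ∀ x y, ι x y → EPath x y)
    (ν : ∀ x y, ι x y → ℝ) (z w : X) : ℝ :=
  ∑ x, ∑ y, πt x * Pt x y * ∑ i, ν x y i * (Γ x y i).len * (Γ x y i).edgeCount z w

/-- The **CONGESTION RATIO for randomized paths**, eq. (13.16):
`B := max_{e ∈ E} (1/Q(e)) Σ_{(x,y) ∈ Ẽ} Q̃(x,y) Σ_{Γ : e ∈ Γ ∈ 𝒫xy} νxy(Γ)|Γ|`, `E = {P > 0}`,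
`Q(z,w) = π(z)P(z,w)` (`⨆` over the finite `E`; `0` if `E = ∅`). [cite: LevinPeres2017, §13.4.1
eq. (13.16)] -/
noncomputable def randCongestionRatio (π : X → ℝ) (P : Matrix X X ℝ) (πt : X → ℝ)
    (Pt : Matrix X X ℝ) (Γ : ∀ x y, ι x y → EPath x y) (ν : ∀ x y, ι x y → ℝ) : ℝ :=
  ⨆ e : {e : X × X // 0 < P e.1 e.2},
    randEdgeCongestion πt Pt Γ ν e.1.1 e.1.2 / (π e.1.1 * P e.1.1 e.1.2)

/-- Every `e ∈ E` has congestion `≤ B·Q(e)` with `B` the ratio (13.16) (for `π > 0`).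
[cite: LevinPeres2017, §13.4.1 eq. (13.16)] -/
theorem randEdgeCongestion_le_ratio_mul {π : X → ℝ} (hπ : ∀ x, 0 < π x) (P : Matrix X X ℝ)
    (πt : X → ℝ) (Pt : Matrix X X ℝ) (Γ : ∀ x y, ι x y → EPath x y) (ν : ∀ x y, ι x y → ℝ)
    {z w : X} (hzw : 0 < P z w) :
    randEdgeCongestion πt Pt Γ ν z w ≤ randCongestionRatio π P πt Pt Γ ν * (π z * P z w) := by
  have hQ : 0 < π z * P z w := mul_pos (hπ z) hzw
  have h : randEdgeCongestion πt Pt Γ ν z w / (π z * P z w) ≤ randCongestionRatio π P πt Pt Γ ν :=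
    le_ciSup (f := fun e : {e : X × X // 0 < P e.1 e.2} =>
      randEdgeCongestion πt Pt Γ ν e.1.1 e.1.2 / (π e.1.1 * P e.1.1 e.1.2))
      (Set.finite_range _).bddAbove ⟨(z, w), hzw⟩
  rwa [div_le_iff₀ hQ] at h

omit [DecidableEq X] [∀ x y, Fintype (ι x y)] in
/-- Exchange of a double sum with a double sum. [folklore] -/
private theorem sum_sum_sum_sum_comm' (F : X → X → X → X → ℝ) :
    ∑ x, ∑ y, ∑ z, ∑ w, F x y z w = ∑ z, ∑ w, ∑ x, ∑ y, F x y z w := by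
  calc ∑ x, ∑ y, ∑ z, ∑ w, F x y z w
      = ∑ x, ∑ z, ∑ y, ∑ w, F x y z w := sum_congr rfl fun x _ => Finset.sum_comm
    _ = ∑ x, ∑ z, ∑ w, ∑ y, F x y z w :=
        sum_congr rfl fun x _ => sum_congr rfl fun z _ => Finset.sum_comm
    _ = ∑ z, ∑ x, ∑ w, ∑ y, F x y z w := Finset.sum_comm
    _ = ∑ z, ∑ w, ∑ x, ∑ y, F x y z w := sum_congr rfl fun z _ => Finset.sum_comm

omit [DecidableEq X] [∀ x y, Fintype (ι x y)] in
/-- Exchange for one pair: `Q · Σ_i a_i Σ_{z,w} c_i(z,w) g(z,w) = Σ_{z,w} [Q Σ_i a_i c_i(z,w)] g(z,w)`.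
[folklore] -/
private theorem mul_sum_mul_sum_sum {κ : Type*} [Fintype κ] (Q : ℝ) (a : κ → ℝ)
    (c : κ → X → X → ℝ) (g : X → X → ℝ) :
    Q * ∑ i, a i * ∑ z, ∑ w, c i z w * g z w = ∑ z, ∑ w, (Q * ∑ i, a i * c i z w) * g z w := by
  calc Q * ∑ i, a i * ∑ z, ∑ w, c i z w * g z w
      = Q * ∑ i, ∑ z, ∑ w, a i * (c i z w * g z w) := by simp_rw [Finset.mul_sum]
    _ = Q * ∑ z, ∑ i, ∑ w, a i * (c i z w * g z w) := by rw [Finset.sum_comm]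
    _ = Q * ∑ z, ∑ w, ∑ i, a i * (c i z w * g z w) :=
        congrArg (Q * ·) (sum_congr rfl fun z _ => Finset.sum_comm)
    _ = ∑ z, ∑ w, Q * ∑ i, a i * (c i z w * g z w) := by simp_rw [Finset.mul_sum]
    _ = ∑ z, ∑ w, (Q * ∑ i, a i * c i z w) * g z w := by
        refine sum_congr rfl fun z _ => sum_congr rfl fun w _ => ?_
        rw [mul_assoc, Finset.sum_mul]
        congr 1
        exact sum_congr rfl fun i _ => by ring

/-! ## Corollary 13.23 -/

/-- Randomized comparison, all-pairs form: if `ν ≥ 0`, `Σ_i νxy(i) = 1` whenever `Q̃(x,y) > 0`,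
`π̃, P̃ ≥ 0`, and `Σ_{(x,y)} Q̃(x,y) Σ_{Γ ∋ (z,w)} νxy(Γ)|Γ| ≤ B·π(z)P(z,w)` for EVERY pair `(z,w)`, then
`𝓔̃(f) ≤ B𝓔(f)`. [cite: LevinPeres2017, §13.4.1 Cor 13.23 (proof, Exercise 13.3)] -/
theorem dirichletForm_le_mul_of_randEdgeCongestion_le {π πt : X → ℝ} {P Pt : Matrix X X ℝ}
    (hπt0 : ∀ x, 0 ≤ πt x) (hPt0 : ∀ x y, 0 ≤ Pt x y) (Γ : ∀ x y, ι x y → EPath x y)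
    {ν : ∀ x y, ι x y → ℝ} (hν0 : ∀ x y i, 0 ≤ ν x y i)
    (hν1 : ∀ x y, 0 < πt x * Pt x y → ∑ i, ν x y i = 1) {B : ℝ}
    (hB : ∀ z w, randEdgeCongestion πt Pt Γ ν z w ≤ B * (π z * P z w)) (f : X → ℝ) :
    dirichletForm πt Pt f ≤ B * dirichletForm π P f := by
  -- Step 1, pair by pair: `Q̃(x,y)[f(x) − f(y)]² = Q̃(x,y) Σ_i ν_i [f(x) − f(y)]²
  --   ≤ Q̃(x,y) Σ_i ν_i |Γ_i| Σ_{(z,w)} edgeCount_i(z,w) [f(w) − f(z)]²`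
  have h1 : ∀ x y, πt x * Pt x y * (f x - f y) ^ 2 ≤ πt x * Pt x y *
      ∑ i, ν x y i * (Γ x y i).len *
        ∑ z, ∑ w, ((Γ x y i).edgeCount z w : ℝ) * (f w - f z) ^ 2 := by
    intro x y
    have hQ0 : 0 ≤ πt x * Pt x y := mul_nonneg (hπt0 x) (hPt0 x y)
    rcases hQ0.lt_or_eq with hQ | hQ
    · refine mul_le_mul_of_nonneg_left ?_ hQ0
      -- `[f(x) − f(y)]² = Σ_i ν_i [f(x) − f(y)]²` and the path-wise Cauchy–Schwarz bound
      calc (f x - f y) ^ 2 = ∑ i, ν x y i * (f x - f y) ^ 2 := by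
            rw [← Finset.sum_mul, hν1 x y hQ, one_mul]
        _ ≤ ∑ i, ν x y i * ((Γ x y i).len *
              ∑ z, ∑ w, ((Γ x y i).edgeCount z w : ℝ) * (f w - f z) ^ 2) := by
            refine sum_le_sum fun i _ => mul_le_mul_of_nonneg_left ?_ (hν0 x y i)
            have h := (Γ x y i).sq_sub_le f
            rwa [(Γ x y i).sum_range_eq_sum_edgeCount (fun z w => (f w - f z) ^ 2)] at h
        _ = _ := sum_congr rfl fun i _ => by ring
    · rw [← hQ, zero_mul, zero_mul]
  -- Step 2: exchange of summation, the sum of the right-hand sides is `Σ_{(z,w)} congestion(z,w)[f(w) − f(z)]²`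
  have h2 : ∑ x, ∑ y, πt x * Pt x y * ∑ i, ν x y i * (Γ x y i).len *
      ∑ z, ∑ w, ((Γ x y i).edgeCount z w : ℝ) * (f w - f z) ^ 2 =
      ∑ z, ∑ w, randEdgeCongestion πt Pt Γ ν z w * (f w - f z) ^ 2 := by
    calc ∑ x, ∑ y, πt x * Pt x y * ∑ i, ν x y i * (Γ x y i).len *
          ∑ z, ∑ w, ((Γ x y i).edgeCount z w : ℝ) * (f w - f z) ^ 2
        = ∑ x, ∑ y, ∑ z, ∑ w, (πt x * Pt x y *
            ∑ i, ν x y i * (Γ x y i).len * ((Γ x y i).edgeCount z w : ℝ)) * (f w - f z) ^ 2 :=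
          sum_congr rfl fun x _ => sum_congr rfl fun y _ =>
            mul_sum_mul_sum_sum (πt x * Pt x y) (fun i => ν x y i * ((Γ x y i).len : ℝ))
              (fun i z w => ((Γ x y i).edgeCount z w : ℝ)) (fun z w => (f w - f z) ^ 2)
      _ = ∑ z, ∑ w, ∑ x, ∑ y, (πt x * Pt x y *
            ∑ i, ν x y i * (Γ x y i).len * ((Γ x y i).edgeCount z w : ℝ)) * (f w - f z) ^ 2 :=
          sum_sum_sum_sum_comm' _
      _ = ∑ z, ∑ w, randEdgeCongestion πt Pt Γ ν z w * (f w - f z) ^ 2 := by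
          unfold randEdgeCongestion
          simp_rw [Finset.sum_mul]
  -- Step 3: the congestion bound
  have h3 : ∑ z, ∑ w, randEdgeCongestion πt Pt Γ ν z w * (f w - f z) ^ 2 ≤
      B * ∑ z, ∑ w, π z * P z w * (f z - f w) ^ 2 := by
    rw [Finset.mul_sum]
    refine sum_le_sum fun z _ => ?_
    rw [Finset.mul_sum]
    refine sum_le_sum fun w _ => ?_
    calc randEdgeCongestion πt Pt Γ ν z w * (f w - f z) ^ 2 ≤ B * (π z * P z w) * (f w - f z) ^ 2 :=
          mul_le_mul_of_nonneg_right (hB z w) (sq_nonneg _)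
      _ = B * (π z * P z w * (f z - f w) ^ 2) := by ring
  have h12 : ∑ x, ∑ y, πt x * Pt x y * (f x - f y) ^ 2 ≤
      ∑ z, ∑ w, randEdgeCongestion πt Pt Γ ν z w * (f w - f z) ^ 2 := by
    rw [← h2]
    exact sum_le_sum fun x _ => sum_le_sum fun y _ => h1 x y
  unfold dirichletForm
  calc (1 / 2 : ℝ) * ∑ x, ∑ y, πt x * Pt x y * (f x - f y) ^ 2
      ≤ (1 / 2) * (B * ∑ z, ∑ w, π z * P z w * (f z - f w) ^ 2) :=
        mul_le_mul_of_nonneg_left (h12.trans h3) (by norm_num)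
    _ = B * ((1 / 2) * ∑ z, ∑ w, π z * P z w * (f z - f w) ^ 2) := by ring

/-- For randomized `E`-paths on `Ẽ`, a pair `(z,w)` with `P(z,w) ≤ 0` carries no congestion.
[cite: LevinPeres2017, §13.4.1 (the paths of `𝒫xy` use edges of `E`)] -/
theorem randEdgeCongestion_eq_zero_of_isIn {πt : X → ℝ} {P Pt : Matrix X X ℝ}
    (hPt0 : ∀ x y, 0 ≤ Pt x y) (Γ : ∀ x y, ι x y → EPath x y) (ν : ∀ x y, ι x y → ℝ)
    (hE : ∀ x y, 0 < Pt x y → ∀ i, (Γ x y i).IsIn P) {z w : X} (hzw : P z w ≤ 0) :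
    randEdgeCongestion πt Pt Γ ν z w = 0 := by
  unfold randEdgeCongestion
  refine Finset.sum_eq_zero fun x _ => Finset.sum_eq_zero fun y _ => ?_
  rcases (hPt0 x y).lt_or_eq with hxy | hxy
  · rw [Finset.sum_eq_zero fun i _ => ?_, mul_zero]
    rw [EPath.edgeCount_eq_zero_of_isIn (hE x y hxy i) hzw, Nat.cast_zero, mul_zero]
  · rw [← hxy, mul_zero, zero_mul]

/-- **Corollary 13.23, Dirichlet-form inequality** (the randomized analogue of (13.14)): let
`P ≥ 0`, `π̃, P̃ ≥ 0`; for each `(x,y) ∈ Ẽ` let `νxy` be a probability vector on a finite set `𝒫xy` of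
`E`-paths from `x` to `y`; if `Σ_{(x,y)} Q̃(x,y) Σ_{Γ ∋ e} νxy(Γ)|Γ| ≤ B·Q(e)` for every `e ∈ E` (i.e.
`B` is at least the congestion ratio (13.16)), then **`𝓔̃(f) ≤ B𝓔(f)`** for all `f`.
[cite: LevinPeres2017, §13.4.1 Cor 13.23 (proof "exactly parallel to that of Theorem 13.20";
Exercise 13.3)] -/
theorem LevinPeres2017_cor_13_23_dirichletForm {π πt : X → ℝ} {P Pt : Matrix X X ℝ}
    (hP0 : ∀ x y, 0 ≤ P x y) (hπt0 : ∀ x, 0 ≤ πt x) (hPt0 : ∀ x y, 0 ≤ Pt x y)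
    (Γ : ∀ x y, ι x y → EPath x y) (hE : ∀ x y, 0 < Pt x y → ∀ i, (Γ x y i).IsIn P)
    {ν : ∀ x y, ι x y → ℝ} (hν0 : ∀ x y i, 0 ≤ ν x y i)
    (hν1 : ∀ x y, 0 < Pt x y → ∑ i, ν x y i = 1) {B : ℝ}
    (hB : ∀ z w, 0 < P z w → randEdgeCongestion πt Pt Γ ν z w ≤ B * (π z * P z w)) (f : X → ℝ) :
    dirichletForm πt Pt f ≤ B * dirichletForm π P f := by
  refine dirichletForm_le_mul_of_randEdgeCongestion_le hπt0 hPt0 Γ hν0 (fun x y hQ => ?_)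
    (fun z w => ?_) f
  · exact hν1 x y (pos_of_mul_pos_right hQ (hπt0 x))
  · rcases (hP0 z w).lt_or_eq with hzw | hzw
    · exact hB z w hzw
    · rw [randEdgeCongestion_eq_zero_of_isIn hPt0 Γ ν hE hzw.symm.le, ← hzw, mul_zero, mul_zero]

/-- **Corollary 13.23.**  Let `P` and `P̃` be reversible transition matrices with positive stationary
probability vectors `π` and `π̃` on a finite `X` (`|X| ≥ 2`).  If, for randomized `E`-paths
(`νxy` a probability vector on a finite set of `E`-paths from `x` to `y`, for each `(x,y) ∈ Ẽ`),
`B` satisfies `Σ_{(x,y)} Q̃(x,y) Σ_{Γ ∋ e} νxy(Γ)|Γ| ≤ B·Q(e)` on `E` — in particular for `B` the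
congestion ratio (13.16) — then **`γ̃ ≤ [max_x π(x)/π̃(x)]·B·γ`** (13.17).
[cite: LevinPeres2017, §13.4.1 Cor 13.23 eq. (13.17)] -/
theorem LevinPeres2017_cor_13_23 [Nontrivial X] {π πt : X → ℝ} (hπ : ∀ x, 0 < π x)
    (hπ1 : ∑ x, π x = 1) (hπt : ∀ x, 0 < πt x) (hπt1 : ∑ x, πt x = 1) {P Pt : Matrix X X ℝ}
    (hP : IsRowStochastic P) (hDB : DetailedBalance π P) (hPt : IsRowStochastic Pt)
    (hDBt : DetailedBalance πt Pt) (Γ : ∀ x y, ι x y → EPath x y)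
    (hE : ∀ x y, 0 < Pt x y → ∀ i, (Γ x y i).IsIn P) {ν : ∀ x y, ι x y → ℝ}
    (hν0 : ∀ x y i, 0 ≤ ν x y i) (hν1 : ∀ x y, 0 < Pt x y → ∑ i, ν x y i = 1) {B : ℝ}
    (hB : ∀ z w, 0 < P z w → randEdgeCongestion πt Pt Γ ν z w ≤ B * (π z * P z w)) :
    spectralGap πt Pt ≤ (⨆ x, π x / πt x) * B * spectralGap π P :=
  LevinPeres2017_lemma_13_18_max hπ hπ1 hπt hπt1 hP hDB hPt hDBt
    (LevinPeres2017_cor_13_23_dirichletForm hP.1 (fun x => (hπt x).le) hPt.1 Γ hE hν0 hν1 hB)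

/-- **Corollary 13.23 with `B` = the congestion ratio (13.16) itself**: `γ̃ ≤ [max_x π(x)/π̃(x)]·B·γ`.
[cite: LevinPeres2017, §13.4.1 Cor 13.23 eq. (13.16)–(13.17)] -/
theorem LevinPeres2017_cor_13_23_ratio [Nontrivial X] {π πt : X → ℝ} (hπ : ∀ x, 0 < π x)
    (hπ1 : ∑ x, π x = 1) (hπt : ∀ x, 0 < πt x) (hπt1 : ∑ x, πt x = 1) {P Pt : Matrix X X ℝ}
    (hP : IsRowStochastic P) (hDB : DetailedBalance π P) (hPt : IsRowStochastic Pt)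
    (hDBt : DetailedBalance πt Pt) (Γ : ∀ x y, ι x y → EPath x y)
    (hE : ∀ x y, 0 < Pt x y → ∀ i, (Γ x y i).IsIn P) {ν : ∀ x y, ι x y → ℝ}
    (hν0 : ∀ x y i, 0 ≤ ν x y i) (hν1 : ∀ x y, 0 < Pt x y → ∑ i, ν x y i = 1) :
    spectralGap πt Pt ≤
      (⨆ x, π x / πt x) * randCongestionRatio π P πt Pt Γ ν * spectralGap π P :=
  LevinPeres2017_cor_13_23 hπ hπ1 hπt hπt1 hP hDB hPt hDBt Γ hE hν0 hν1
    fun _ _ hzw => randEdgeCongestion_le_ratio_mul hπ P πt Pt Γ ν hzw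

end Literature.Probability.MarkovChains
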